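import Literature.Computability.AlgebraicComplexity.IK20HighestWeightVectors
import Mathlib.LinearAlgebra.Dual.Lemmas
import HarnessLib

/-!
# Ikenmeyer–Kandasamy 2020, Claim 10.2, proved: `dim ({λ}_ϱ)^{𝔖_m} = dim ({λ}^{Dϱ})^{stab ϱ}`

Topic `Literature/Computability/AlgebraicComplexity`; proofs file (theorems only, no new
definitions of record, no named facts). Discharges the named fact `IK2020_claim_10_2` of
`IK20HighestWeightVectors.lean` (C. Ikenmeyer, U. Kandasamy, STOC 2020 = arXiv:1911.03990,
Claim 10.2, TeX L862–896; honest framing: a piece of finite-dimensional linear algebra inside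
IK's proof of their Prop. 10.1; nothing here bears on VP versus VNP).

Printed proof (TeX L865–896), followed: with `W = {λ}`, `W_ϱ = ⊕_j π_j W^ϱ` over coset
representatives of `stab ϱ ≤ 𝔖_m`, the projection `p : (W_ϱ)^{𝔖_m} → (W^ϱ)^{stab ϱ}` onto the
summand `W^ϱ` is an isomorphism: well defined (`stab ϱ` fixes `W^ϱ`), injective (an invariant
vector is determined by its `W^ϱ`-component, `v_j = π_j v_1`), surjective
(`v = ∑_j π_j v_1 = |stab ϱ|⁻¹ ∑_{π ∈ 𝔖_m} π v_1`). We realise the inverse of `p` as the averaging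
map `w ↦ ∑_{π ∈ 𝔖_m} π · w` (up to the factor `|stab ϱ|`) and prove it bijective onto the
invariants; the decomposition of `W_ϱ` into weight spaces is direct by the linear independence of
torus characters (tree: `eq_zero_of_sum_mul_weightChar_eq_zero`, `OrbitClosureWeights.lean`).

General lemmas (any representation of `GL_m(k)`): permutation matrices conjugate diagonal
matrices to diagonal matrices with permuted entries, hence carry the weight space of `χ` to the
weight space of `χ ∘ π⁻¹` (Fulton–Harris §15.3: the Weyl group `𝔖_m` permutes the weights); a
finite sum of vectors of pairwise distinct weights vanishes only if each does (Fulton–Harris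
§15.3 / Goodman–Wallach §3.1.3, weight space decomposition).

## References
* C. Ikenmeyer, U. Kandasamy, arXiv:1911.03990, §10, Claim 10.2. [IkenmeyerKandasamy2019]
* W. Fulton, J. Harris, *Representation Theory*, GTM 129, §15.3. [FultonHarrisGTM129]
-/

noncomputable section

open scoped BigOperators

namespace Literature.Computability.AlgebraicComplexity

open _root_.Literature.NumberTheory.DiophantineGeometry

namespace IK2020

section PermWeights

variable {k : Type*} [Field k] {m : ℕ} {V : Type*} [AddCommGroup V] [Module k V]
  (ρ : Representation k (GL (Fin m) k) V)

/-- The matrix of `permGL π` is the permutation matrix of `π⁻¹` (`e_i ↦ e_{π i}`).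
[cite: IkenmeyerKandasamy2019, §7] -/
theorem coe_permGL (π : Equiv.Perm (Fin m)) :
    ((permGL k π : GL (Fin m) k) : Matrix (Fin m) (Fin m) k) = (π⁻¹).permMatrix k :=
  Matrix.GeneralLinearGroup.val_mkOfDetNeZero _ _

/-- `permGL` is multiplicative: `P_σ P_π = P_{σπ}`. [cite: IkenmeyerKandasamy2019, §7] -/
theorem permGL_mul (σ π : Equiv.Perm (Fin m)) :
    permGL k σ * permGL k π = permGL k (σ * π) := by
  apply Units.ext
  rw [Units.val_mul, coe_permGL, coe_permGL, coe_permGL, mul_inv_rev, Matrix.permMatrix_mul]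

/-- `permGL 1 = 1`. [cite: IkenmeyerKandasamy2019, §7] -/
theorem permGL_one : permGL k (1 : Equiv.Perm (Fin m)) = 1 := by
  apply Units.ext
  rw [coe_permGL, inv_one, Matrix.permMatrix_one, Units.val_one]

/-- `(P_π)⁻¹ = P_{π⁻¹}`. [cite: IkenmeyerKandasamy2019, §7] -/
theorem permGL_inv (π : Equiv.Perm (Fin m)) : (permGL k π)⁻¹ = permGL k π⁻¹ :=
  inv_eq_of_mul_eq_one_right (by rw [permGL_mul, mul_inv_cancel, permGL_one])

/-- Conjugating a diagonal matrix by a permutation matrix permutes its diagonal: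
`P_π⁻¹ t P_π = diag(t_{π i, π i})`. (Fulton–Harris §15.3: the Weyl group `𝔖_m` acts on the
torus.) [cite: FultonHarrisGTM129, §15.3] -/
theorem coe_permGL_inv_mul_mul_permGL {t : GL (Fin m) k} (ht : IsDiagonalGL t)
    (π : Equiv.Perm (Fin m)) :
    ((permGL k π⁻¹ * t * permGL k π : GL (Fin m) k) : Matrix (Fin m) (Fin m) k) =
      Matrix.diagonal fun i => (t : Matrix (Fin m) (Fin m) k) (π i) (π i) := by
  rw [Units.val_mul, Units.val_mul, coe_permGL, coe_permGL, inv_inv]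
  nth_rw 1 [coe_eq_diagonal_of_isDiagonalGL ht]
  rw [Equiv.Perm.permMatrix, Equiv.Perm.permMatrix, PEquiv.toMatrix_toPEquiv_mul,
    PEquiv.mul_toMatrix_toPEquiv, Matrix.submatrix_submatrix]
  change (Matrix.diagonal fun i => (t : Matrix (Fin m) (Fin m) k) i i).submatrix (⇑π) (⇑π) = _
  rw [Matrix.submatrix_diagonal_equiv]
  rfl

/-- The conjugate `P_π⁻¹ t P_π` of a diagonal `t` is diagonal. [cite: FultonHarrisGTM129, §15.3] -/
theorem isDiagonalGL_conj_permGL {t : GL (Fin m) k} (ht : IsDiagonalGL t)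
    (π : Equiv.Perm (Fin m)) : IsDiagonalGL (permGL k π⁻¹ * t * permGL k π) := by
  rw [isDiagonalGL_iff_isDiag, coe_permGL_inv_mul_mul_permGL ht]
  exact Matrix.isDiag_diagonal _

/-- The character of weight `χ` at `P_π⁻¹ t P_π` is the character of weight `χ ∘ π⁻¹` at `t`.
[cite: FultonHarrisGTM129, §15.3] -/
theorem weightChar_conj_permGL (χ : Weight (Fin m)) {t : GL (Fin m) k} (ht : IsDiagonalGL t)
    (π : Equiv.Perm (Fin m)) :
    weightChar χ (permGL k π⁻¹ * t * permGL k π) = weightChar (fun i => χ (π.symm i)) t := by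
  unfold weightChar
  simp only [coe_permGL_inv_mul_mul_permGL ht, Matrix.diagonal_apply_eq]
  exact (Equiv.prod_comp π (fun j => (t : Matrix (Fin m) (Fin m) k) j j ^ χ (π.symm j))).symm.trans
    (by simp) |>.symm

/-- **Permutation matrices permute weight spaces**: if `v` has weight `χ` then `P_π · v` has weight
`χ ∘ π⁻¹` (Fulton–Harris §15.3: the Weyl group `𝔖_m` permutes the weights of a
`GL_m`-representation). [cite: FultonHarrisGTM129, §15.3] -/
theorem permGL_mem_weightSpace {χ : Weight (Fin m)} {v : V} (hv : v ∈ weightSpace ρ χ)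
    (π : Equiv.Perm (Fin m)) :
    ρ (permGL k π) v ∈ weightSpace ρ (fun i => χ (π.symm i)) := by
  intro t ht
  have hconj := hv _ (isDiagonalGL_conj_permGL ht π)
  rw [weightChar_conj_permGL χ ht π] at hconj
  calc ρ t (ρ (permGL k π) v)
      = ρ (permGL k π) (ρ (permGL k π⁻¹ * t * permGL k π) v) := by
        rw [← Module.End.mul_apply, ← map_mul, ← Module.End.mul_apply, ← map_mul]
        congr 2
        rw [← mul_assoc, ← mul_assoc, ← permGL_inv, mul_inv_cancel, one_mul]
    _ = weightChar (fun i => χ (π.symm i)) t • ρ (permGL k π) v := by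
        rw [hconj, map_smul]

/-- **Weight vectors of distinct weights are linearly independent**: over an infinite field, if a
finite sum of vectors of pairwise distinct weights vanishes, every summand vanishes (torus
characters are linearly independent — tree `eq_zero_of_sum_mul_weightChar_eq_zero` — applied to
every linear functional). Fulton–Harris §15.3; Goodman–Wallach §3.1.3.
[cite: FultonHarrisGTM129, §15.3] -/
theorem eq_zero_of_sum_weightVectors_eq_zero [Infinite k] (O : Finset (Weight (Fin m)))
    (w : Weight (Fin m) → V) (hw : ∀ γ ∈ O, w γ ∈ weightSpace ρ γ) (h0 : ∑ γ ∈ O, w γ = 0) :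
    ∀ γ ∈ O, w γ = 0 := by
  intro γ hγ
  refine (Module.forall_dual_apply_eq_zero_iff k (w γ)).mp fun φ => ?_
  refine eq_zero_of_sum_mul_weightChar_eq_zero O (fun δ => φ (w δ)) (fun t ht => ?_) γ hγ
  have h1 : ρ t (∑ δ ∈ O, w δ) = ∑ δ ∈ O, weightChar δ t • w δ := by
    rw [map_sum]
    exact Finset.sum_congr rfl fun δ hδ => hw δ hδ t ht
  have h2 := congrArg φ h1
  rw [h0, map_zero, map_zero, map_sum] at h2
  rw [h2]
  exact Finset.sum_congr rfl fun δ _ => by rw [map_smul, smul_eq_mul, mul_comm]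

end PermWeights

section Claim

variable {k : Type*} [Field k] {m : ℕ} {V : Type*} [AddCommGroup V] [Module k V]
  (ρ : Representation k (GL (Fin m) k) V) (γ₀ : Weight (Fin m))

/-- `γ₀ ∘ (π σ⁻¹) = γ₀ ∘ σ⁻¹ ↔ γ₀ ∘ π = γ₀` (right cancellation). [folklore] -/
private theorem q_mul_inv_eq_iff (π σ : Equiv.Perm (Fin m)) :
    (fun i => γ₀ ((π * σ⁻¹) i)) = (fun i => γ₀ (σ⁻¹ i)) ↔ (fun i => γ₀ (π i)) = γ₀ := by
  constructor
  · intro h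
    funext j
    have := congrFun h (σ j)
    simpa using this
  · intro h
    funext i
    have := congrFun h (σ⁻¹ i)
    simpa using this

/-- `γ₀ ∘ σ = γ₀ ∘ π ↔ γ₀ ∘ (σ π⁻¹) = γ₀`. [folklore] -/
private theorem q_eq_q_iff (σ π : Equiv.Perm (Fin m)) :
    (fun i => γ₀ (σ i)) = (fun i => γ₀ (π i)) ↔ (fun i => γ₀ ((σ * π⁻¹) i)) = γ₀ := by
  constructor
  · intro h
    funext i
    have := congrFun h (π⁻¹ i)
    simpa using this
  · intro h
    funext j
    have := congrFun h (π j)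
    simpa using this

/-- Infinite field from characteristic zero. [folklore] -/
private theorem infinite_of_charZero [CharZero k] : Infinite k :=
  Infinite.of_injective _ Nat.cast_injective

/-- `avg w` lies in `⨆_π W(γ₀ ∘ π)` for `w` of weight `γ₀`. [folklore] -/
private theorem avg_mem_iSup {w : V} (hw : w ∈ weightSpace ρ γ₀) :
    (∑ π : Equiv.Perm (Fin m), ρ (permGL k π) w) ∈
      ⨆ π : Equiv.Perm (Fin m), weightSpace ρ (fun i => γ₀ (π i)) := by
  refine Submodule.sum_mem _ fun π _ => ?_
  have h := permGL_mem_weightSpace ρ hw π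
  exact (le_iSup (fun π : Equiv.Perm (Fin m) => weightSpace ρ (fun i => γ₀ (π i))) π⁻¹) h

/-- `avg v` is fixed by every `P_σ`. [folklore] -/
private theorem permGL_avg (σ : Equiv.Perm (Fin m)) (v : V) :
    ρ (permGL k σ) (∑ π : Equiv.Perm (Fin m), ρ (permGL k π) v) =
      ∑ π : Equiv.Perm (Fin m), ρ (permGL k π) v := by
  rw [map_sum]
  simp_rw [← Module.End.mul_apply, ← map_mul, permGL_mul]
  exact Fintype.sum_equiv (Equiv.mulLeft σ) _ _ fun π => rfl

/-- Uniqueness of the weight decomposition along the orbit of `γ₀`: two families adapted to the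
weights `γ₀ ∘ π` with the same sum have the same fibre sums. [cite: FultonHarrisGTM129, §15.3] -/
private theorem fiber_sum_eq [CharZero k] {u u' : Equiv.Perm (Fin m) → V}
    (hu : ∀ π, u π ∈ weightSpace ρ (fun i => γ₀ (π i)))
    (hu' : ∀ π, u' π ∈ weightSpace ρ (fun i => γ₀ (π i)))
    (h : ∑ π, u π = ∑ π, u' π) (π₀ : Equiv.Perm (Fin m)) :
    (∑ π, if (fun i => γ₀ (π i)) = (fun i => γ₀ (π₀ i)) then u π else 0) =
      ∑ π, if (fun i => γ₀ (π i)) = (fun i => γ₀ (π₀ i)) then u' π else 0 := by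
  classical
  haveI := infinite_of_charZero (k := k)
  let qf : Equiv.Perm (Fin m) → Weight (Fin m) := fun π i => γ₀ (π i)
  set O : Finset (Weight (Fin m)) := Finset.univ.image qf with hO
  have hmemO : ∀ π : Equiv.Perm (Fin m), (fun i => γ₀ (π i)) ∈ O := fun π =>
    Finset.mem_image_of_mem qf (Finset.mem_univ π)
  set w : Weight (Fin m) → V :=
    fun γ => ∑ π, if (fun i => γ₀ (π i)) = γ then u π - u' π else 0 with hw
  have hwmem : ∀ γ ∈ O, w γ ∈ weightSpace ρ γ := by
    intro γ _
    refine Submodule.sum_mem _ fun π _ => ?_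
    split_ifs with hπ
    · rw [← hπ]; exact Submodule.sub_mem _ (hu π) (hu' π)
    · exact Submodule.zero_mem _
  have hsum : ∑ γ ∈ O, w γ = 0 := by
    simp only [hw]
    rw [Finset.sum_comm]
    have : ∀ π : Equiv.Perm (Fin m),
        (∑ γ ∈ O, if (fun i => γ₀ (π i)) = γ then u π - u' π else 0) = u π - u' π := by
      intro π
      rw [Finset.sum_ite_eq, if_pos (hmemO π)]
    simp_rw [this]
    rw [Finset.sum_sub_distrib, h, sub_self]
  have hz := eq_zero_of_sum_weightVectors_eq_zero ρ O w hwmem hsum (fun i => γ₀ (π₀ i)) (hmemO π₀)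
  simp only [hw] at hz
  rw [← sub_eq_zero, ← Finset.sum_sub_distrib]
  rw [← hz]
  refine Finset.sum_congr rfl fun π _ => ?_
  split_ifs <;> simp

/-- The number of `σ ∈ 𝔖_m` with `γ₀ ∘ σ = γ₀ ∘ π` does not depend on `π`. [folklore] -/
private theorem card_fiber_eq (π : Equiv.Perm (Fin m)) :
    (Finset.univ.filter fun σ : Equiv.Perm (Fin m) =>
        (fun i => γ₀ (σ i)) = (fun i => γ₀ (π i))).card =
      (Finset.univ.filter fun σ : Equiv.Perm (Fin m) => (fun i => γ₀ (σ i)) = γ₀).card := by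
  refine Finset.card_bij (fun σ _ => σ * π⁻¹) (fun σ hσ => ?_) (fun σ _ σ' _ h => ?_)
    (fun τ hτ => ⟨τ * π, ?_, by simp⟩)
  · simp only [Finset.mem_filter, Finset.mem_univ, true_and] at hσ ⊢
    exact (q_eq_q_iff γ₀ σ π).mp hσ
  · simpa using h
  · simp only [Finset.mem_filter, Finset.mem_univ, true_and] at hτ ⊢
    rw [q_eq_q_iff, mul_inv_cancel_right]
    exact hτ

/-- **IK Claim 10.2 in general form.** For a representation `ρ` of `GL_m(k)` (`char k = 0`) and a
weight `γ₀`: the `𝔖_m`-invariants (through the permutation matrices `permGL`) of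
`⨆_π W(γ₀ ∘ π)` and the `stab(γ₀)`-invariants of the weight space `W(γ₀)` have the same dimension;
the averaging map `w ↦ ∑_π P_π w` is an isomorphism between them (IK, proof of Claim 10.2,
TeX L865–896). [cite: IkenmeyerKandasamy2019, Claim 10.2] -/
theorem finrank_permInvariants_iSup_weightSpace_eq [CharZero k] (S : Set (Equiv.Perm (Fin m)))
    (hS : ∀ π, π ∈ S ↔ (fun i => γ₀ (π i)) = γ₀) :
    Module.finrank k ↥((⨆ π : Equiv.Perm (Fin m), weightSpace ρ (fun i => γ₀ (π i))) ⊓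
        ⨅ π ∈ (Set.univ : Set (Equiv.Perm (Fin m))),
          LinearMap.eqLocus (ρ (permGL k π)) LinearMap.id) =
      Module.finrank k ↥(weightSpace ρ γ₀ ⊓
        ⨅ π ∈ S, LinearMap.eqLocus (ρ (permGL k π)) LinearMap.id) := by
  classical
  -- notation
  set U : Submodule k V := ⨆ π : Equiv.Perm (Fin m), weightSpace ρ (fun i => γ₀ (π i)) with hU
  set Fix : Submodule k V := U ⊓ ⨅ π ∈ (Set.univ : Set (Equiv.Perm (Fin m))),
    LinearMap.eqLocus (ρ (permGL k π)) LinearMap.id with hFix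
  set Tgt : Submodule k V := weightSpace ρ γ₀ ⊓
    ⨅ π ∈ S, LinearMap.eqLocus (ρ (permGL k π)) LinearMap.id with hTgt
  have mem_Fix : ∀ v, v ∈ Fix ↔ v ∈ U ∧ ∀ σ, ρ (permGL k σ) v = v := by
    intro v
    simp only [hFix, Submodule.mem_inf, Submodule.mem_iInf, LinearMap.mem_eqLocus, Set.mem_univ,
      LinearMap.id_coe, id_eq, forall_true_left]
  have mem_Tgt : ∀ w, w ∈ Tgt ↔ w ∈ weightSpace ρ γ₀ ∧ ∀ σ ∈ S, ρ (permGL k σ) w = w := by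
    intro w
    simp only [hTgt, Submodule.mem_inf, Submodule.mem_iInf, LinearMap.mem_eqLocus, LinearMap.id_coe,
      id_eq]
  have hS1 : (1 : Equiv.Perm (Fin m)) ∈ S := (hS 1).mpr rfl
  have hSinv : ∀ σ ∈ S, σ⁻¹ ∈ S := by
    intro σ hσ
    rw [hS] at hσ ⊢
    funext i
    have := congrFun hσ (σ⁻¹ i)
    simp only [Equiv.Perm.coe_inv, Equiv.apply_symm_apply] at this ⊢
    exact this.symm
  -- the averaging map restricted to `Tgt`, with values in `Fix`
  have avg_mem : ∀ w ∈ Tgt, (∑ π : Equiv.Perm (Fin m), ρ (permGL k π) w) ∈ Fix := by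
    intro w hw
    rw [mem_Fix]
    exact ⟨avg_mem_iSup ρ γ₀ ((mem_Tgt w).mp hw).1, fun σ => permGL_avg ρ σ w⟩
  let A : Tgt →ₗ[k] Fix :=
    { toFun := fun w => ⟨∑ π : Equiv.Perm (Fin m), ρ (permGL k π) (w : V), avg_mem w w.2⟩
      map_add' := fun w w' => by ext; simp [map_add, Finset.sum_add_distrib]
      map_smul' := fun c w => by ext; simp [map_smul, Finset.smul_sum] }
  -- the size of the stabilizer, nonzero in characteristic zero
  set N : ℕ := (Finset.univ.filter fun σ : Equiv.Perm (Fin m) => (fun i => γ₀ (σ i)) = γ₀).card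
    with hN
  have hN0 : (N : k) ≠ 0 := by
    rw [Nat.cast_ne_zero]
    exact Finset.card_ne_zero.mpr ⟨1, by simp⟩
  -- injectivity
  have hinj : Function.Injective A := by
    rw [← LinearMap.ker_eq_bot, LinearMap.ker_eq_bot']
    intro w hw
    have hw0 : (∑ π : Equiv.Perm (Fin m), ρ (permGL k π) (w : V)) = 0 := by
      have := congrArg (fun x : Fix => (x : V)) hw
      simpa [A] using this
    obtain ⟨hwW, hwS⟩ := (mem_Tgt w).mp w.2
    -- the family `u π = P_{π⁻¹} w`
    set u : Equiv.Perm (Fin m) → V := fun π => ρ (permGL k π⁻¹) w with hu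
    have huW : ∀ π, u π ∈ weightSpace ρ (fun i => γ₀ (π i)) := by
      intro π
      have h := permGL_mem_weightSpace ρ hwW π⁻¹
      simp only [Equiv.Perm.inv_def, Equiv.symm_symm] at h
      exact h
    have husum : ∑ π, u π = ∑ π : Equiv.Perm (Fin m), (fun _ => (0 : V)) π := by
      simp only [hu, Finset.sum_const_zero]
      rw [← hw0]
      exact Fintype.sum_equiv (Equiv.inv (Equiv.Perm (Fin m))) _ _ fun π => rfl
    have hfib := fiber_sum_eq ρ γ₀ huW (fun π => Submodule.zero_mem _) husum 1
    have q1 : (fun i => γ₀ ((1 : Equiv.Perm (Fin m)) i)) = γ₀ := rfl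
    rw [q1] at hfib
    simp only [ite_self, Finset.sum_const_zero] at hfib
    -- on the stabilizer fibre every `u π` equals `w`
    have hfib' :
        (∑ π : Equiv.Perm (Fin m), if (fun i => γ₀ (π i)) = γ₀ then (w : V) else 0) = 0 := by
      refine Eq.trans (Finset.sum_congr rfl fun π _ => ?_) hfib
      split_ifs with hπ
      · exact (hwS π⁻¹ (hSinv π ((hS π).mpr hπ))).symm
      · rfl
    rw [Finset.sum_ite, Finset.sum_const_zero, add_zero, Finset.sum_const, ← hN,
      ← Nat.cast_smul_eq_nsmul k, smul_eq_zero] at hfib'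
    rcases hfib' with h | h
    · exact absurd h hN0
    · exact Subtype.ext h
  -- surjectivity
  have hsurj : Function.Surjective A := by
    intro v
    obtain ⟨hvU, hvS⟩ := (mem_Fix v).mp v.2
    -- decompose `v` along the weight spaces `W(γ₀ ∘ π)`
    have hvU' : (v : V) ∈ ⨆ π ∈ (Finset.univ : Finset (Equiv.Perm (Fin m))),
        weightSpace ρ (fun i => γ₀ (π i)) := by
      simpa [hU] using hvU
    obtain ⟨μ, hμ⟩ := (Submodule.mem_iSup_finset_iff_exists_sum _ _).mp hvU'
    set u : Equiv.Perm (Fin m) → V := fun π => (μ π : V) with hu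
    have huW : ∀ π, u π ∈ weightSpace ρ (fun i => γ₀ (π i)) := fun π => (μ π).2
    have husum : ∑ π, u π = v := hμ
    -- the `γ₀`-component
    set c₀ : V := ∑ π, if (fun i => γ₀ (π i)) = γ₀ then u π else 0 with hc₀
    have hc₀W : c₀ ∈ weightSpace ρ γ₀ := by
      refine Submodule.sum_mem _ fun π _ => ?_
      split_ifs with hπ
      · rw [← hπ]; exact huW π
      · exact Submodule.zero_mem _
    -- KEY: `P_σ c₀` is the `(γ₀ ∘ σ⁻¹)`-component of `v`
    have key : ∀ σ : Equiv.Perm (Fin m),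
        ρ (permGL k σ) c₀ =
          ∑ π, if (fun i => γ₀ (π i)) = (fun i => γ₀ (σ⁻¹ i)) then u π else 0 := by
      intro σ
      -- the translated family
      set u' : Equiv.Perm (Fin m) → V := fun π => ρ (permGL k σ) (u (π * σ)) with hu'
      have hu'W : ∀ π, u' π ∈ weightSpace ρ (fun i => γ₀ (π i)) := by
        intro π
        have h := permGL_mem_weightSpace ρ (huW (π * σ)) σ
        have hq : (fun i => (fun i => γ₀ ((π * σ) i)) (σ.symm i)) = (fun i => γ₀ (π i)) := by
          funext i; simp
        rw [hq] at h
        exact h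
      have hu'sum : ∑ π, u' π = ∑ π, u π := by
        simp only [hu']
        rw [← map_sum, Fintype.sum_equiv (Equiv.mulRight σ) (fun π => u (π * σ)) u fun π => rfl,
          husum]
        exact hvS σ
      have hfib := fiber_sum_eq ρ γ₀ hu'W huW hu'sum σ⁻¹
      rw [← hfib]
      simp only [hu']
      rw [map_sum]
      -- reindex `π ↦ π σ⁻¹`
      refine Fintype.sum_equiv (Equiv.mulRight σ⁻¹) _ _ fun π => ?_
      simp only [Equiv.coe_mulRight, inv_mul_cancel_right]
      by_cases hπ : (fun i => γ₀ (π i)) = γ₀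
      · rw [if_pos hπ, if_pos ((q_mul_inv_eq_iff γ₀ π σ).mpr hπ)]
      · rw [if_neg hπ, if_neg (fun h => hπ ((q_mul_inv_eq_iff γ₀ π σ).mp h)), map_zero]
    -- `c₀` is `stab`-invariant
    have hc₀S : ∀ σ ∈ S, ρ (permGL k σ) c₀ = c₀ := by
      intro σ hσ
      rw [key σ, hc₀]
      have hq : (fun i => γ₀ (σ⁻¹ i)) = γ₀ := (hS σ⁻¹).mp (hSinv σ hσ)
      simp_rw [hq]
    have hc₀T : c₀ ∈ Tgt := (mem_Tgt c₀).mpr ⟨hc₀W, hc₀S⟩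
    -- `avg c₀ = N • v`
    have havg : (∑ σ : Equiv.Perm (Fin m), ρ (permGL k σ) c₀) = (N : k) • (v : V) := by
      simp_rw [key]
      rw [Fintype.sum_equiv (Equiv.inv (Equiv.Perm (Fin m)))
        (fun σ => ∑ π, if (fun i => γ₀ (π i)) = (fun i => γ₀ (σ⁻¹ i)) then u π else 0)
        (fun σ => ∑ π, if (fun i => γ₀ (π i)) = (fun i => γ₀ (σ i)) then u π else 0) (fun σ => rfl)]
      rw [Finset.sum_comm]
      have hinner : ∀ π : Equiv.Perm (Fin m),
          (∑ σ : Equiv.Perm (Fin m),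
            if (fun i => γ₀ (π i)) = (fun i => γ₀ (σ i)) then u π else 0) = (N : k) • u π := by
        intro π
        rw [Finset.sum_ite, Finset.sum_const_zero, add_zero, Finset.sum_const,
          ← Nat.cast_smul_eq_nsmul k]
        congr 2
        rw [hN, ← card_fiber_eq γ₀ π]
        congr 1
        ext σ
        simp only [Finset.mem_filter, Finset.mem_univ, true_and]
        exact eq_comm
      simp_rw [hinner]
      rw [← Finset.smul_sum, husum]
    refine ⟨⟨(N : k)⁻¹ • c₀, Tgt.smul_mem _ hc₀T⟩, ?_⟩
    apply Subtype.ext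
    change (∑ π : Equiv.Perm (Fin m), ρ (permGL k π) ((N : k)⁻¹ • c₀)) = (v : V)
    simp_rw [map_smul]
    rw [← Finset.smul_sum, havg, smul_smul, inv_mul_cancel₀ hN0, one_smul]
  exact (LinearEquiv.ofBijective A ⟨hinj, hsurj⟩).finrank_eq.symm

end Claim

end IK2020

open IK2020 in
/-- **DISCHARGE of `IK2020_claim_10_2`** (Ikenmeyer–Kandasamy 2020, Claim 10.2, TeX L862–896):
`dim ({λ}_ϱ)^{𝔖_m} = dim ({λ}^{Dϱ})^{stab ϱ}` for the Weyl module `{λ}` of `GL_m(ℂ)`, from the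
general `IK2020.finrank_permInvariants_iSup_weightSpace_eq`.
[cite: IkenmeyerKandasamy2019, Claim 10.2] -/
theorem IK2020_claim_10_2_holds : IK2020_claim_10_2 := by
  intro m D d hD _ lam _ ρp _
  have hD0 : (D : ℤ) ≠ 0 := by exact_mod_cast (show D ≠ 0 by omega)
  have hS : ∀ π : Equiv.Perm (Fin m),
      π ∈ {π : Equiv.Perm (Fin m) |
          ∀ i, Weight.ofPartition m ρp (π i) = Weight.ofPartition m ρp i} ↔
        (fun i => (fun j => (D : ℤ) * Weight.ofPartition m ρp j) (π i)) =
          fun j => (D : ℤ) * Weight.ofPartition m ρp j := by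
    intro π
    rw [Set.mem_setOf_eq]
    constructor
    · intro h
      funext i
      exact congrArg (fun x => (D : ℤ) * x) (h i)
    · intro h i
      exact mul_left_cancel₀ hD0 (congrFun h i)
  have h := finrank_permInvariants_iSup_weightSpace_eq (k := ℂ) (V := ↥(weylModule ℂ (Fin m) lam))
    (weylRep ℂ (Fin m) lam) (fun j => (D : ℤ) * Weight.ofPartition m ρp j) _ hS
  unfold permFixed contentSubspace
  exact h

end Literature.Computability.AlgebraicComplexity

end
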